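import Mathlib.Logic.Relation
import Mathlib.Analysis.Complex.Basic
import Mathlib.Analysis.SpecialFunctions.Pow.Real
import Mathlib.Geometry.Manifold.Instances.Sphere
import Mathlib.Geometry.Manifold.MFDeriv.Basic
import Mathlib.Topology.UnitInterval
import Literature.Topology.FourManifolds.Knots
import Literature.Topology.FourManifolds.GaussDiagrams
import Literature.Topology.FourManifolds.LeeRasmussen
import Literature.AlgebraicTopology.Homotopy.HopfFibration
import HarnessLib

/-!
# The Manolescu–Marengon–Sarkar–Willis invariants `s₋`, `s₊` of null-homologous knots in `#ʳ(S¹ × S²)`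

Topic `Literature/Topology/FourManifolds` (definition item `defn-MMSWRasmussen`, wanted by route
`SmoothPoincare4/DottedCircleRasmussen`, items `DcrRasmussenWitness` / `DcrGfgmw` / `DcrAdjunction` /
`DcrCalibration`).  Manolescu–Marengon–Sarkar–Willis [MMSW] extend Khovanov–Lee homology to links in
`M_r = #ʳ(S¹ × S²)` and define, for a NULL-HOMOLOGOUS oriented link `L ⊂ M_r`, a Rasmussen-type
invariant `s(L) ∈ ℤ` (Def. 3.1, Thms. 1.1–1.4) and the pair `s₋(L) = s(L)`, `s₊(L) = -s(-L)`
(Def. 8.1).  This file defines `s₋` and `s₊` for KNOTS (`|L| = 1`, which is what the route's typed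
items need) in the explicit model of `M_r` used by the route, through MMSW's *finite approximation
theorem*, so that the value is literally an ordinary Rasmussen invariant of a knot in `S³` and the
tree's `Literature.Topology.FourManifolds.Knot.HasRasmussenInvariant` (file `LeeRasmussen`) is reused:

* MMSW, Thm. 1.4 (= Thm. 3.3) and Prop. 8.2 (i): if `D` is a standard diagram of `L` (a picture of
  `L` in the Kirby diagram of `M_r`, i.e. — Def. 8.26 / Remark 8.27 — a diagram `D₀ ⊔ K₁ ⊔ ⋯ ⊔ K_r`
  in `S³` with `K₁ ⊔ ⋯ ⊔ K_r` the standard `r`-component unlink, `0`-surgery on which gives `M_r`)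
  and `D(k⃗)` is the link in `S³` obtained by inserting `k` right-handed full twists into the
  strands passing through each handle, then `s₋(L) = s(D(k⃗))` for all `k ≥ ⌈(n⁺_D + 2)/2⌉`;
  Prop. 8.2 (ii): `s₊(L) = s(D(-k⃗))` for all `k ≥ ⌈(n⁻_D + 2)/2⌉`;
* MMSW, Thm. 1.3 (= Thm. 3.4): the value does not depend on the diagram; Thm. 2.8: it is invariant
  under orientation-preserving self-diffeomorphisms of `M_r`, and the Dehn twist `σ_i` along the
  belt sphere `{pt} × S²` of the `i`-th handle merely replaces `k` by `k ± 1`.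

Hence `s₋(L)` is the EVENTUAL VALUE, as `k → +∞`, of the ordinary Rasmussen invariants of the
`S³`-knots `σ^k(L)` drawn in the standard picture — and this is the definition taken here
(`HasSMinus`), with `σ^k` and the standard picture realised by explicit formulas on the model.

## The model (the route's inline domain; coordinates `z = x₀ + i x₁`, `w = x₂ + i x₃` on `ℝ⁴ = ℂ²`)

* `levelFun r` is `G_r(z, w) = |z|²/(40(r+1))² + Σ_{j<r} 1/|z - c_j|² + |w|²`, `c_j = 4(j+1)`
  (`holeCentre`); `modelHandlebody r = D_r = {G_r ≤ 1}` (with the honest-division guard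
  `1 ≤ |z - c_j|²`, `holeTerm`) is a 4-ball with `r` unknotted proper 2-discs `{z = c_j}` carved
  out, i.e. the dotted-circle picture of a `0`-handle and `r` `1`-handles, `D_r ≅ ♮ʳ(S¹ × B³)`
  [Kirby1989, Ch. I §2]; `modelBoundary r = ∂D_r = {G_r = 1} ≅ #ʳ(S¹ × S²) =: M_r`, ORIENTED as the
  boundary of `D_r ⊂ ℂ²` (MMSW's convention: `M_r` is the boundary of the 1-handlebody).
  Over the planar domain `Ω_r = {z : g_r(z) ≤ 1}` (a disc with `r` holes around the `c_j`) the
  boundary is `{|w|² = 1 - g_r(z)}`: the trivial circle bundle `Ω_r° × S¹` (coordinate `arg w`)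
  with the circles collapsed over `∂Ω_r` (the `r + 1` CORE circles `{w = 0}`).
* `IsModelKnot r K` — a smoothly embedded circle `K : 𝕊¹ → ℝ⁴` with image in `∂D_r`: word for word
  the binder block of the route's items (`C^∞`, injective, injective `mfderiv`, guard, `G_r = 1`).
* `IsNullHomologous r K` — `[K] = 0` in `H₁(M_r; ℤ) ≅ ℤʳ`.  The projection `(z, w) ↦ z` induces
  `H₁(∂D_r) ≅ H₁(Ω_r) ≅ H₁(ℂ ∖ {c_0, …, c_{r-1}})`, the class of a loop being its winding numbers
  about the `c_j` (= its intersection numbers with the belt spheres, = its linking numbers with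
  the dotted circles); so `[K] = 0` iff for every `j` the plane curve `z ∘ K` is freely
  null-homotopic in `ℂ ∖ {c_j}` — stated with an explicit homotopy, no homology theory needed.
* `sphereTwist r k` — `(z, w) ↦ (z, w · u(z)^k)`, `u(z) = Π_j (z - c_j)/|z - c_j|`, `k ∈ ℤ`: a
  self-diffeomorphism of `∂D_r` (it preserves `z` and `|w|`, `levelFun_sphereTwist`) isotopic to
  the product `Π_j σ_j^k` of the `k`-th powers of the sphere twists along the `r` belt spheres
  (on `Ω_r° × S¹` it is `(z, θ) ↦ (z, θ + k Σ_j arg(z - c_j))`, which is isotopic, through maps of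
  the same shape, to the twist supported near the membranes `α_j × S¹`, and near the cores it is a
  rotation of the normal discs — MMSW §2.3, the generator `σ_i`).
* `draw r` — the standard picture: `(z, w) ↦ (planar point (Re z + C_r) · w̄/|w|, height Im z)`,
  `C_r = 100(r+1)` (`drawRadius`): revolving the planar domain about a vertical axis identifies
  `∂D_r ∖ {cores}` with the complement, in `ℝ³ ⊂ S³`, of a closed solid torus around the axis and of
  `r` solid tori around the COAXIAL HORIZONTAL CIRCLES of radii `c_j + C_r` at height `0` — the
  dotted circles, an `r`-component unlink in standard position; the meridian discs `{z₀} × D²` of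
  the inner cores go to `0`-framed longitude discs, those of the outer core to meridian discs of the
  axis torus, so this identification extends to a diffeomorphism `∂D_r ≅ S³_0(unlink)` which is
  ORIENTATION-PRESERVING for the boundary orientation of `∂D_r` (whence the complex conjugate `w̄`;
  checked: the frame `(∂_{x₀}, ∂_{x₁}, ∂_θ)` is positive on `∂D_r` and is carried to a positive
  frame of `ℝ³`).  `toSphereThree` is the inverse of the tree's stereographic chart
  (`planarProjection`, `height` of `GaussDiagrams`): `planarProjection ∘ toSphereThree = p` and
  `height ∘ toSphereThree = h` (proved below), so the tree reads the diagrams of our knots exactly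
  as the pictures drawn by `draw`, viewer at height `+∞`, right-handed crossings positive.
* `finiteApprox r k K = toSphereThree ∘ draw r ∘ sphereTwist r k ∘ K : 𝕊¹ → 𝕊³` — the knot
  `D(k⃗)`: for `k > 0` the strands through each handle acquire `k` RIGHT-handed full twists
  (checked on MMSW's example `F₁(1) = T(2,2)`, Thm. 1.7: two oppositely oriented fibres acquire
  linking number `-1` for `k = 1`).  Inserting the twists along a different spanning disc of a
  dotted circle, or spreading them as `sphereTwist` does, changes `D(k⃗)` only by an isotopy of
  `S³`, to which `Knot.HasRasmussenInvariant` is insensitive by construction.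
* `HasSMinus r K s` — **`s₋(K) = s`** (MMSW Def. 8.1 with Prop. 8.2 (i) as the definition): `K` is
  null-homologous and some model knot `K'` isotopic to `K` through model knots
  (`IsModelIsotopic`, chains of collared smooth isotopies through model knots; = ambient
  isotopy of `∂D_r` by isotopy extension) and missing the cores has `s(finiteApprox r k K') = s` for all large `k`, the value
  being read through `Knot.HasRasmussenInvariant` of the tree (`ApproxHasRasmussen`).  The
  existential over representatives is needed exactly as in `Knot.HasRasmussenInvariant` (a given
  `K` may meet a core circle, where no picture is drawn); MMSW Thms. 1.3, 1.4, 2.8 make the value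
  independent of all choices (`MMSWRasmussenFacts`: `existsUnique_hasSMinus`).
* `HasSPlus r K s` — **`s₊(K) = s`**, i.e. `s₋(ρ ∘ K) = -s` for the reflection
  `ρ(z, w) = (z̄, w)` of `∂D_r` (`modelMirror`; MMSW Def. 8.1: `s₊(L) = -s(-L)`, `-L = r(m(L))`,
  with Prop. 8.8 (1): `s_±` is insensitive to reversal, and Thm. 2.8: any orientation-reversing
  self-diffeomorphism of `M_r` may replace `m`).  In the picture `ρ` is `height ↦ -height`, i.e.
  all crossings changed, and `finiteApprox r k (ρ ∘ K)` is the mirror image of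
  `finiteApprox r (-k) K` (`draw_sphereTwist_modelMirror`) — MMSW's `(mD)(k⃗) = m(D(-k⃗))`
  (proof of Prop. 8.2), so `s₊` is also the eventual value of `s(D(-k⃗))`, Prop. 8.2 (ii).

## What is NOT here (scope)

* Links with `≥ 2` components (MMSW's `s` is Beliakova–Wehrli's for `D(k⃗)`; the tree's
  `GaussDiagram.rasmussenInvariant` is for knot diagrams), hence not Thm. 1.6 (`s(F_p) = 1 - 2p`)
  nor the connected-sum formula Thm. 1.14; no diagrams `D` of links in `M_r` and their moves
  [MW, §3.1], hence not the explicit threshold `k ≥ ⌈(n⁺_D + 2)/2⌉` of Thm. 1.4 (only eventual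
  constancy is used); no Lee homology in `M_r` (Def. 3.1 itself).
* The theorems of MMSW about `s_±` (well-definedness, `s₋ ≤ s₊`, genus bounds Thm. 1.15 /
  Lemma 8.19) are named facts in `MMSWRasmussenFacts.lean`.

## References

* C. Manolescu, M. Marengon, S. Sarkar, M. Willis, *A generalization of Rasmussen's invariant, with
  applications to surfaces in some four-manifolds*, Duke Math. J. 172 (2023) 231–311
  (arXiv:1910.08195): Def. 3.1, Thms. 1.3, 1.4 (= 3.3, 3.4), §2.1 (diagrams, `D(k⃗)`), §2.3 and
  Thm. 2.8 (`σ_i`), Def. 8.1, Prop. 8.2, Def. 8.26 / Remark 8.27, Prop. 8.8. [ManolescuMarengonSarkarWillis2023]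
* R. Kirby, *The Topology of 4-Manifolds*, LNM 1374 (1989), Ch. I §2 (dotted circles: the 1-handle
  `S¹ × B³` as `B⁴` minus a pushed-in spanning disc; `0`-surgery picture of `#ᵏ S¹ × S²`,
  Lemma 2.1). [Kirby1989]
* Mathlib: spheres as manifolds, `ContMDiff`, `mfderiv`, `unitInterval`; the tree: `Knot`,
  `Knot.HasRasmussenInvariant`, `planarProjection`, `height`, and the complex coordinates
  `zC`, `wC`, `ofZW` of `ℝ⁴ = ℂ²` from `AlgebraicTopology/Homotopy/HopfFibration`.  Mathlib has no knots in
  3-manifolds other than what the tree provides (searched `Rasmussen`, `Khovanov`, `dotted`).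

## Convention checks (recorded in the item's NOTES; numerical, on the formulas below)

orientation: `det[∇G, ∂_{x₀}, ∂_{x₁}, ∂_θ] > 0` on `∂D_r` and `d(draw)` has positive determinant
on that frame (negative with `w` in place of `w̄`); the inverse stereographic map is
orientation-preserving from `(p₀, p₁, h)`-space; chirality: Gauss linking integrals `-1.000`
(`k = 1`), `+1.000` (`k = -1`), `0.000` (`k = 0`) for the oppositely oriented fibre pair of
`S¹ × S²`, `+1.000` for the co-oriented pair at `k = 1`.
-/

open scoped Manifold ContDiff Topology BigOperators ComplexConjugate
open Function Set

noncomputable section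

namespace Literature.Topology.FourManifolds

/-- Local notation: `𝔼 n` is the model Euclidean space `EuclideanSpace ℝ (Fin n)`. -/
local notation "𝔼 " n:arg => EuclideanSpace ℝ (Fin n)

/-- Local notation: `𝕊 n` is the unit sphere in `EuclideanSpace ℝ (Fin (n + 1))`. -/
local notation "𝕊 " n:arg => (Metric.sphere (0 : EuclideanSpace ℝ (Fin (n + 1))) 1)

namespace MMSW

open Literature.AlgebraicTopology.Homotopy.HopfFibration (zC wC ofZW zC_ofZW wC_ofZW ofZW_zC_wC
  continuous_zC continuous_wC)

/-! ## The model dotted handlebody `D_r ⊂ ℝ⁴` and its boundary `M_r = #ʳ(S¹ × S²)` -/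

/-- The centre `c_j = 4(j+1) ∈ ℝ ⊂ ℂ` of the `j`-th hole of the planar domain (the `j`-th dotted
circle of the model is carved out above `z = c_j`). The route's inline constant. [folklore] -/
def holeCentre (r : ℕ) (j : Fin r) : ℂ := ((4 * (((j : ℕ) : ℝ) + 1) : ℝ) : ℂ)

/-- `|z - c_j|²` in real coordinates: `(x₀ - 4(j+1))² + x₁²`, literally as in the route's items.
[folklore] -/
def holeTerm (r : ℕ) (j : Fin r) (x : 𝔼 4) : ℝ :=
  (x 0 - 4 * (((j : ℕ) : ℝ) + 1)) ^ 2 + (x 1) ^ 2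

/-- The level function `G_r(x) = (x₀² + x₁²)/(40(r+1))² + Σ_{j<r} 1/((x₀ - 4(j+1))² + x₁²) + x₂² + x₃²`
of the model dotted handlebody, literally as in the route's items (`1/0 = 0` at the poles
`z = c_j`, which the guard of `modelBoundary`/`modelHandlebody` excludes). Its regular level
`G_r = 1` is `#ʳ(S¹ × S²)`, the sublevel set `♮ʳ(S¹ × B³)` [Kirby1989, Ch. I §2]. [folklore] -/
def levelFun (r : ℕ) (x : 𝔼 4) : ℝ :=
  ((x 0) ^ 2 + (x 1) ^ 2) / (40 * ((r : ℝ) + 1)) ^ 2 + (∑ j : Fin r, 1 / holeTerm r j x) +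
    (x 2) ^ 2 + (x 3) ^ 2

/-- The model `M_r = ∂D_r`: the level set `{G_r = 1}` together with the honest-division guard
`1 ≤ |z - c_j|²` (automatic for the true, pole-containing, function). A closed smooth
hypersurface of `ℝ⁴` (the critical values of `G_r` are `< 1`: they occur at `w = 0` and the
saddles of the planar potential, of height `< 0.9`), diffeomorphic to `#ʳ(S¹ × S²)` — the
boundary of the dotted-circle handlebody `modelHandlebody r` — and ORIENTED as that boundary.
[cite: Kirby1989, Ch. I §2] -/
def modelBoundary (r : ℕ) : Set (𝔼 4) :=
  {x | (∀ j : Fin r, (1 : ℝ) ≤ holeTerm r j x) ∧ levelFun r x = 1}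

/-- The model dotted handlebody `D_r = {G_r ≤ 1}` (with the guard): a smooth compact domain in
`ℝ⁴`, a 4-ball with the `r` flat proper discs `{z = c_j}` carved out, i.e. `B⁴ ∪ r` one-handles
`≅ ♮ʳ(S¹ × B³)` in dotted-circle notation. [cite: Kirby1989, Ch. I §2] -/
def modelHandlebody (r : ℕ) : Set (𝔼 4) :=
  {x | (∀ j : Fin r, (1 : ℝ) ≤ holeTerm r j x) ∧ levelFun r x ≤ 1}

/-- The interior `{G_r < 1}` (with the guard) of the model dotted handlebody. [folklore] -/
def modelInterior (r : ℕ) : Set (𝔼 4) :=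
  {x | (∀ j : Fin r, (1 : ℝ) ≤ holeTerm r j x) ∧ levelFun r x < 1}

variable {r : ℕ}

/-- Membership in the model boundary, unfolded. [folklore] -/
theorem mem_modelBoundary_iff (x : 𝔼 4) :
    x ∈ modelBoundary r ↔ (∀ j : Fin r, (1 : ℝ) ≤ holeTerm r j x) ∧ levelFun r x = 1 :=
  Iff.rfl

/-- Membership in the model handlebody, unfolded. [folklore] -/
theorem mem_modelHandlebody_iff (x : 𝔼 4) :
    x ∈ modelHandlebody r ↔ (∀ j : Fin r, (1 : ℝ) ≤ holeTerm r j x) ∧ levelFun r x ≤ 1 :=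
  Iff.rfl

/-- Membership in the model interior, unfolded. [folklore] -/
theorem mem_modelInterior_iff (x : 𝔼 4) :
    x ∈ modelInterior r ↔ (∀ j : Fin r, (1 : ℝ) ≤ holeTerm r j x) ∧ levelFun r x < 1 :=
  Iff.rfl

/-- The boundary lies in the handlebody. [folklore] -/
theorem modelBoundary_subset_modelHandlebody : modelBoundary r ⊆ modelHandlebody r :=
  fun _ hx ↦ ⟨hx.1, hx.2.le⟩

/-- The interior lies in the handlebody. [folklore] -/
theorem modelInterior_subset_modelHandlebody : modelInterior r ⊆ modelHandlebody r :=
  fun _ hx ↦ ⟨hx.1, hx.2.le⟩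

/-- Boundary and interior are disjoint. [folklore] -/
theorem disjoint_modelBoundary_modelInterior : Disjoint (modelBoundary r) (modelInterior r) :=
  Set.disjoint_left.2 fun _ hb hi ↦ hi.2.ne hb.2

/-! ## Model knots -/

/-- A **model knot** in `M_r`: a smoothly embedded circle `K : 𝕊¹ → ℝ⁴` — `C^∞`, injective, with
injective differential — whose image lies in the model boundary `∂D_r`. Word for word the
binder block of the route `SmoothPoincare4/DottedCircleRasmussen` (items `DcrGap`, …); MMSW's
"knot in `#ʳ(S¹ × S²)`" [cite: ManolescuMarengonSarkarWillis2023, §2.1] -/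
def IsModelKnot (r : ℕ) (K : 𝕊 1 → 𝔼 4) : Prop :=
  ContMDiff (𝓡 1) 𝓘(ℝ, 𝔼 4) ∞ K ∧ Injective K ∧
    (∀ t, Injective (mfderiv (𝓡 1) 𝓘(ℝ, 𝔼 4) K t)) ∧ ∀ t, K t ∈ modelBoundary r

/-- `IsModelKnot` unfolded to the literal conjunction used by the route's items. [folklore] -/
theorem isModelKnot_iff (K : 𝕊 1 → 𝔼 4) :
    IsModelKnot r K ↔
      ContMDiff (𝓡 1) 𝓘(ℝ, 𝔼 4) ∞ K ∧ Injective K ∧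
        (∀ t, Injective (mfderiv (𝓡 1) 𝓘(ℝ, 𝔼 4) K t)) ∧
          ∀ t, (∀ j : Fin r, (1 : ℝ) ≤ (K t 0 - 4 * (((j : ℕ) : ℝ) + 1)) ^ 2 + (K t 1) ^ 2) ∧
            ((K t 0) ^ 2 + (K t 1) ^ 2) / (40 * ((r : ℝ) + 1)) ^ 2 +
                  (∑ j : Fin r, 1 / ((K t 0 - 4 * (((j : ℕ) : ℝ) + 1)) ^ 2 + (K t 1) ^ 2)) +
                (K t 2) ^ 2 + (K t 3) ^ 2 = 1 :=
  Iff.rfl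

/-- A model knot is continuous. [folklore] -/
theorem IsModelKnot.continuous {K : 𝕊 1 → 𝔼 4} (h : IsModelKnot r K) : Continuous K :=
  h.1.continuous

/-- A model knot lies on the model boundary. [folklore] -/
theorem IsModelKnot.mem {K : 𝕊 1 → 𝔼 4} (h : IsModelKnot r K) (t : 𝕊 1) :
    K t ∈ modelBoundary r :=
  h.2.2.2 t

/-! ## Complex coordinates `z = x₀ + i x₁`, `w = x₂ + i x₃`

The coordinates `zC`, `wC : ℝ⁴ → ℂ` and `ofZW : ℂ → ℂ → ℝ⁴` are those of the tree's
`Literature.AlgebraicTopology.Homotopy.HopfFibration` (opened above). -/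

/-- `Re z = x₀`. [folklore] -/
@[simp] theorem zC_re (x : 𝔼 4) : (zC x).re = x 0 := rfl

/-- `Im z = x₁`. [folklore] -/
@[simp] theorem zC_im (x : 𝔼 4) : (zC x).im = x 1 := rfl

/-- `Re w = x₂`. [folklore] -/
@[simp] theorem wC_re (x : 𝔼 4) : (wC x).re = x 2 := rfl

/-- `Im w = x₃`. [folklore] -/
@[simp] theorem wC_im (x : 𝔼 4) : (wC x).im = x 3 := rfl

attribute [local simp] ofZW_zC_wC

/-- The hole term is `|z - c_j|²`. [folklore] -/
theorem holeTerm_eq_normSq (j : Fin r) (x : 𝔼 4) :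
    holeTerm r j x = Complex.normSq (zC x - holeCentre r j) := by
  simp [holeTerm, holeCentre, Complex.normSq_apply, zC, sq]

/-- The level function in complex coordinates:
`G_r = |z|²/(40(r+1))² + Σ_j 1/|z - c_j|² + |w|²`. [folklore] -/
theorem levelFun_eq (x : 𝔼 4) :
    levelFun r x = Complex.normSq (zC x) / (40 * ((r : ℝ) + 1)) ^ 2 +
      (∑ j : Fin r, 1 / Complex.normSq (zC x - holeCentre r j)) + Complex.normSq (wC x) := by
  simp only [levelFun, holeTerm_eq_normSq, Complex.normSq_apply, zC, wC]
  ring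

/-- Under the guard the point `z` is not a hole centre. [folklore] -/
theorem zC_ne_holeCentre {x : 𝔼 4} (hx : ∀ j : Fin r, (1 : ℝ) ≤ holeTerm r j x) (j : Fin r) :
    zC x ≠ holeCentre r j := by
  intro h
  have := hx j
  rw [holeTerm_eq_normSq, h, sub_self, map_zero] at this
  exact absurd this (by norm_num)

/-! ## Null-homologous knots -/

/-- **`[K] = 0` in `H₁(M_r; ℤ)`** for a loop `K` in the model boundary: for every hole `j` the
plane curve `z ∘ K` is freely null-homotopic in `ℂ ∖ {c_j}` — there is a continuous
`H : [0,1] × 𝕊¹ → ℂ ∖ {c_j}` from `z ∘ K` to a constant loop.  Equivalently all winding numbers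
of `z ∘ K` about the `c_j` vanish, i.e. all linking numbers of `K` with the dotted circles
(intersection numbers with the belt spheres `{pt} × S²`) vanish: `H₁(#ʳ(S¹ × S²)) ≅ ℤʳ` is
detected by them, and `(z, w) ↦ z` induces `H₁(∂D_r) ≅ H₁(ℂ ∖ {c_0, …, c_{r-1}})`.  MMSW's
standing hypothesis "`L` null-homologous". [cite: ManolescuMarengonSarkarWillis2023, Thm. 1.1 and §3.1] -/
def IsNullHomologous (r : ℕ) (K : 𝕊 1 → 𝔼 4) : Prop :=
  ∀ j : Fin r, ∃ H : unitInterval × (𝕊 1) → ℂ, Continuous H ∧ (∀ p, H p ≠ holeCentre r j) ∧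
    (∀ t, H (0, t) = zC (K t)) ∧ ∃ c : ℂ, ∀ t, H (1, t) = c

/-- With no handles (`r = 0`, `M_0 = S³`) every loop is null-homologous. [folklore] -/
theorem isNullHomologous_zero (K : 𝕊 1 → 𝔼 4) : IsNullHomologous 0 K :=
  fun j ↦ j.elim0

/-! ## The sphere twists `σ^k` -/

/-- The unit complex number `u(z) = Π_j (z - c_j)/|z - c_j|` (junk `0` factors at the poles
`z = c_j`, excluded by the guard): `arg u` increases by `2π` around each hole. [folklore] -/
def twistUnit (r : ℕ) (z : ℂ) : ℂ :=
  ∏ j : Fin r, (z - holeCentre r j) / ((‖z - holeCentre r j‖ : ℝ) : ℂ)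

/-- Away from the hole centres `u(z)` has modulus one. [folklore] -/
theorem norm_twistUnit {z : ℂ} (hz : ∀ j : Fin r, z ≠ holeCentre r j) : ‖twistUnit r z‖ = 1 := by
  simp only [twistUnit, norm_prod, norm_div, Complex.norm_real, Real.norm_eq_abs, abs_norm]
  refine Finset.prod_eq_one fun j _ ↦ ?_
  have : ‖z - holeCentre r j‖ ≠ 0 := norm_ne_zero_iff.2 (sub_ne_zero.2 (hz j))
  exact div_self this

/-- Away from the hole centres `u(z) ≠ 0`. [folklore] -/
theorem twistUnit_ne_zero {z : ℂ} (hz : ∀ j : Fin r, z ≠ holeCentre r j) : twistUnit r z ≠ 0 :=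
  norm_ne_zero_iff.1 (by rw [norm_twistUnit hz]; exact one_ne_zero)

/-- The hole centres are real, so `u(z̄) = conj (u z)`. [folklore] -/
theorem twistUnit_conj (z : ℂ) : twistUnit r (conj z) = conj (twistUnit r z) := by
  simp only [twistUnit, map_prod, map_div₀, Complex.conj_ofReal]
  refine Finset.prod_congr rfl fun j _ ↦ ?_
  have hc : conj (holeCentre r j) = holeCentre r j := Complex.conj_ofReal _
  rw [map_sub, hc, ← Complex.norm_conj (z - holeCentre r j), map_sub, hc]

/-- **The sphere twist** `σ^k : (z, w) ↦ (z, w · u(z)^k)`, `k ∈ ℤ`: on `∂D_r ∖ {cores} = Ω_r° × S¹`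
it rotates the fibre coordinate `arg w` by `k · Σ_j arg(z - c_j)`; it fixes the cores and rotates
their normal discs.  It is a self-diffeomorphism of `M_r = ∂D_r` isotopic to the product over `j`
of the `k`-th powers of the Dehn twists `σ_j` along the belt spheres `{pt} × S²` of the handles
(MMSW §2.3), which in the standard picture "simply adds a full twist onto the link diagram near
the attaching sphere, effectively changing `k` to `k ± 1`" (proof of Thm. 2.8); for `k > 0` the
twists added to strands through a handle are right-handed (module docstring).
[cite: ManolescuMarengonSarkarWillis2023, §2.3 and Thm. 2.8] -/
def sphereTwist (r : ℕ) (k : ℤ) (x : 𝔼 4) : 𝔼 4 :=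
  ofZW (zC x) (wC x * twistUnit r (zC x) ^ k)

/-- The sphere twists do not move `z`. [cite: ManolescuMarengonSarkarWillis2023, §2.3] -/
@[simp] theorem zC_sphereTwist (k : ℤ) (x : 𝔼 4) : zC (sphereTwist r k x) = zC x := by
  simp [sphereTwist]

/-- The sphere twists multiply `w` by `u(z)^k`. [cite: ManolescuMarengonSarkarWillis2023, §2.3] -/
@[simp] theorem wC_sphereTwist (k : ℤ) (x : 𝔼 4) :
    wC (sphereTwist r k x) = wC x * twistUnit r (zC x) ^ k := by
  simp [sphereTwist]

/-- `σ^0 = id`. [folklore] -/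
@[simp] theorem sphereTwist_zero (x : 𝔼 4) : sphereTwist r 0 x = x := by
  simp [sphereTwist]

/-- The sphere twists do not move `z`, hence preserve the hole terms. [folklore] -/
@[simp] theorem holeTerm_sphereTwist (j : Fin r) (k : ℤ) (x : 𝔼 4) :
    holeTerm r j (sphereTwist r k x) = holeTerm r j x := by
  rw [holeTerm_eq_normSq, holeTerm_eq_normSq, zC_sphereTwist]

/-- `σ^j ∘ σ^k = σ^{k+j}` away from the poles (in particular on the model boundary). [folklore] -/
theorem sphereTwist_sphereTwist {x : 𝔼 4} (hx : ∀ j : Fin r, (1 : ℝ) ≤ holeTerm r j x) (j k : ℤ) :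
    sphereTwist r j (sphereTwist r k x) = sphereTwist r (k + j) x := by
  have hu := twistUnit_ne_zero (zC_ne_holeCentre hx)
  simp only [sphereTwist, zC_ofZW, wC_ofZW, mul_assoc, ← zpow_add₀ hu]

/-- The sphere twists preserve the level function `G_r` (they preserve `z` and `|w|`).
[cite: ManolescuMarengonSarkarWillis2023, §2.3] -/
theorem levelFun_sphereTwist {x : 𝔼 4} (hx : ∀ j : Fin r, (1 : ℝ) ≤ holeTerm r j x) (k : ℤ) :
    levelFun r (sphereTwist r k x) = levelFun r x := by
  have h1 : Complex.normSq (twistUnit r (zC x) ^ k) = 1 := by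
    rw [Complex.normSq_eq_norm_sq, norm_zpow, norm_twistUnit (zC_ne_holeCentre hx), one_zpow,
      one_pow]
  rw [levelFun_eq, levelFun_eq, zC_sphereTwist, wC_sphereTwist, map_mul, h1, mul_one]

/-- The sphere twists map the model boundary `M_r` to itself.
[cite: ManolescuMarengonSarkarWillis2023, §2.3] -/
theorem sphereTwist_mem_modelBoundary {x : 𝔼 4} (hx : x ∈ modelBoundary r) (k : ℤ) :
    sphereTwist r k x ∈ modelBoundary r :=
  ⟨fun j ↦ by rw [holeTerm_sphereTwist]; exact hx.1 j, by rw [levelFun_sphereTwist hx.1, hx.2]⟩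

/-- `σ^{-k} ∘ σ^{k} = id` on the model boundary: the sphere twists are bijections of `M_r`.
[folklore] -/
theorem sphereTwist_neg_sphereTwist {x : 𝔼 4} (hx : ∀ j : Fin r, (1 : ℝ) ≤ holeTerm r j x)
    (k : ℤ) : sphereTwist r (-k) (sphereTwist r k x) = x := by
  rw [sphereTwist_sphereTwist hx, add_neg_cancel, sphereTwist_zero]

/-! ## The standard picture and the finite approximations `D(k⃗)` -/

/-- The offset `C_r = 100(r+1)` of the axis of revolution (any constant `> 40(r+1) ≥ sup |Re z|`
on the planar domain would do). [folklore] -/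
def drawRadius (r : ℕ) : ℝ := 100 * ((r : ℝ) + 1)

/-- The planar position, as a complex number, of the standard picture of the point `(z, w)`:
`(Re z + C_r) · w̄/|w|` (junk `0` when `w = 0`). [folklore] -/
def drawC (r : ℕ) (x : 𝔼 4) : ℂ :=
  (((zC x).re + drawRadius r : ℝ) : ℂ) * conj (wC x) / ((‖wC x‖ : ℝ) : ℂ)

/-- **The standard picture** of `M_r ∖ {cores}` in `ℝ³ = ℝ² × ℝ`: the point `(z, w)`, `w ≠ 0`, is
drawn at planar position `(Re z + C_r) · w̄/|w| ∈ ℂ = ℝ²` and height `Im z` — the planar domain,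
placed in a vertical half-plane at distance `C_r` from a vertical axis, is revolved about that
axis by the angle `-arg w`.  The image is the complement of a solid torus about the axis and of
`r` solid tori about the coaxial horizontal circles of radii `c_j + C_r` at height `0`, the dotted
circles; this is an orientation-preserving identification of `M_r ∖ {cores}` with the complement
of the (thickened) standard `r`-component unlink, extending to `M_r ≅ S³_0(unlink)` (Kirby's
`0`-surgery picture of `#ʳ S¹ × S²`; MMSW Def. 8.26 / Remark 8.27).  Junk value (axis point) when
`w = 0`. [cite: Kirby1989, Ch. I §2, Lemma 2.1] -/
def draw (r : ℕ) (x : 𝔼 4) : (ℝ × ℝ) × ℝ :=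
  (((drawC r x).re, (drawC r x).im), (zC x).im)

/-- **Inverse stereographic projection** `ℝ² × ℝ → 𝕊³ ∖ {northPole}`,
`(p, h) ↦ (2p₀, 2p₁, 2h, |p|² + h² - 1)/(|p|² + h² + 1)`: the inverse of the tree's chart
`(planarProjection, height)` of `GaussDiagrams` (`planarProjection_toSphereThree`,
`height_toSphereThree`), orientation-preserving for the standard orientations.
[cite: RolfsenKnotsLinks1976, §3.E] -/
def toSphereThree (p : ℝ × ℝ) (h : ℝ) : 𝕊 3 :=
  ⟨(1 / (p.1 ^ 2 + p.2 ^ 2 + h ^ 2 + 1)) •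
      !₂[2 * p.1, 2 * p.2, 2 * h, p.1 ^ 2 + p.2 ^ 2 + h ^ 2 - 1], by
    have hS : 0 < p.1 ^ 2 + p.2 ^ 2 + h ^ 2 + 1 := by positivity
    rw [mem_sphere_zero_iff_norm, norm_smul, Real.norm_eq_abs, abs_of_pos (by positivity)]
    have : ‖(!₂[2 * p.1, 2 * p.2, 2 * h, p.1 ^ 2 + p.2 ^ 2 + h ^ 2 - 1] : 𝔼 4)‖ =
        p.1 ^ 2 + p.2 ^ 2 + h ^ 2 + 1 := by
      rw [EuclideanSpace.norm_eq, show p.1 ^ 2 + p.2 ^ 2 + h ^ 2 + 1 =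
        Real.sqrt ((p.1 ^ 2 + p.2 ^ 2 + h ^ 2 + 1) ^ 2) by rw [Real.sqrt_sq hS.le]]
      congr 1
      simp [Fin.sum_univ_four, sq_abs]
      ring
    rw [this]
    field_simp⟩

/-- The coordinates of the inverse stereographic projection. [folklore] -/
theorem coe_toSphereThree (p : ℝ × ℝ) (h : ℝ) :
    ((toSphereThree p h : 𝕊 3) : 𝔼 4) = (1 / (p.1 ^ 2 + p.2 ^ 2 + h ^ 2 + 1)) •
      !₂[2 * p.1, 2 * p.2, 2 * h, p.1 ^ 2 + p.2 ^ 2 + h ^ 2 - 1] :=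
  rfl

/-- The tree's planar projection (stereographic from the north pole, `GaussDiagrams`) of
`toSphereThree p h` is `p`: our pictures ARE the diagrams the tree reads.
[cite: RolfsenKnotsLinks1976, §3.E] -/
@[simp] theorem planarProjection_toSphereThree (p : ℝ × ℝ) (h : ℝ) :
    planarProjection (toSphereThree p h) = p := by
  have hS : 0 < p.1 ^ 2 + p.2 ^ 2 + h ^ 2 + 1 := by positivity
  simp only [planarProjection, coe_toSphereThree]
  refine Prod.ext ?_ ?_ <;> simp <;> field_simp <;> ring

/-- The tree's height function of `toSphereThree p h` is `h` (so "over/under" in our pictures is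
"over/under" for the tree, viewer at height `+∞`). [cite: RolfsenKnotsLinks1976, §3.E] -/
@[simp] theorem height_toSphereThree (p : ℝ × ℝ) (h : ℝ) : height (toSphereThree p h) = h := by
  have hS : 0 < p.1 ^ 2 + p.2 ^ 2 + h ^ 2 + 1 := by positivity
  simp only [height, coe_toSphereThree]
  simp
  field_simp
  ring

/-- The inverse stereographic projection is injective. [folklore] -/
theorem toSphereThree_injective : Injective (fun q : (ℝ × ℝ) × ℝ ↦ toSphereThree q.1 q.2) := by
  rintro ⟨p, h⟩ ⟨p', h'⟩ hq
  have h1 := congrArg planarProjection hq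
  have h2 := congrArg height hq
  simp only [planarProjection_toSphereThree, height_toSphereThree] at h1 h2
  simp [h1, h2]

/-- **The finite approximation `D(k⃗)`** of the model knot `K`, `k⃗ = (k, …, k)`, `k ∈ ℤ`: the knot
`𝕊¹ → 𝕊³` obtained by applying the sphere twist `σ^k` and drawing the result in the standard
picture (then placing `ℝ³` in `𝕊³` by `toSphereThree`).  For a knot missing the cores this is a
smooth knot in `S³` isotopic to MMSW's `D(k⃗)` — "`k` right-handed full twists inserted in place of
each handle" — for the standard diagram `D` of `K` drawn by `draw`.
[cite: ManolescuMarengonSarkarWillis2023, §2.1 (Fig. InsertTwists) and Prop. 8.2] -/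
def finiteApprox (r : ℕ) (k : ℤ) (K : 𝕊 1 → 𝔼 4) (t : 𝕊 1) : 𝕊 3 :=
  toSphereThree (draw r (sphereTwist r k (K t))).1 (draw r (sphereTwist r k (K t))).2

/-- `D(k⃗)` of `σ^j(K)` is `D(k⃗ + j⃗)` of `K` (for `K` in the model boundary): the Dehn twist along a
belt sphere shifts the full-twist stabilisation — the mechanism of MMSW's Thm. 2.8 for `σ_i`.
[cite: ManolescuMarengonSarkarWillis2023, Thm. 2.8 (proof)] -/
theorem finiteApprox_sphereTwist_comp {K : 𝕊 1 → 𝔼 4} (hK : ∀ t, K t ∈ modelBoundary r)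
    (j k : ℤ) : finiteApprox r k (sphereTwist r j ∘ K) = finiteApprox r (j + k) K := by
  funext t
  simp only [finiteApprox, Function.comp_apply, sphereTwist_sphereTwist (hK t).1]

/-! ## Isotopy of model knots, and the invariants `s₋`, `s₊` -/

/-- **A smooth isotopy of model knots** from `K` to `K'`: a *collared smooth isotopy through
model knots* — a jointly `C^∞` family `H : ℝ × 𝕊¹ → ℝ⁴` with `H_s = K` for `s ≤ 0`, `H_s = K'`
for `s ≥ 1`, every `H_s` a model knot.  By the isotopy extension theorem (Hirsch, *Differential
Topology*, §8.1, Thm. 1.3) this is ambient isotopy in `M_r = ∂D_r`, i.e. "the same knot in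
`#ʳ(S¹ × S²)`". [cite: Hirsch1976, §8.1] -/
def IsSmoothModelIsotopy (r : ℕ) (K K' : 𝕊 1 → 𝔼 4) : Prop :=
  ∃ H : (ℝ → (𝕊 1) → 𝔼 4),
    ContMDiff (𝓘(ℝ, ℝ).prod (𝓡 1)) 𝓘(ℝ, 𝔼 4) ∞ (fun p : ℝ × (𝕊 1) ↦ H p.1 p.2) ∧
      (∀ s, s ≤ 0 → H s = K) ∧ (∀ s, 1 ≤ s → H s = K') ∧ ∀ s, IsModelKnot r (H s)

/-- **Isotopy of model knots** (`K` and `K'` are the same knot in `M_r`): the transitive closure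
of `IsSmoothModelIsotopy` (chains of collared smooth isotopies through model knots; smooth
isotopy is already transitive — reparametrise and concatenate — so this is the same relation,
in a form whose equivalence-relation properties are formal). [cite: Hirsch1976, §8.1] -/
def IsModelIsotopic (r : ℕ) : (𝕊 1 → 𝔼 4) → (𝕊 1 → 𝔼 4) → Prop :=
  Relation.TransGen (IsSmoothModelIsotopy r)

/-- A model knot is smoothly isotopic to itself (constant isotopy). [folklore] -/
theorem IsSmoothModelIsotopy.refl {K : 𝕊 1 → 𝔼 4} (hK : IsModelKnot r K) :
    IsSmoothModelIsotopy r K K := by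
  refine ⟨fun _ ↦ K, ?_, fun _ _ ↦ rfl, fun _ _ ↦ rfl, fun _ ↦ hK⟩
  exact hK.1.comp contMDiff_snd

/-- The source of a smooth isotopy of model knots is a model knot. [folklore] -/
theorem IsSmoothModelIsotopy.isModelKnot_left {K K' : 𝕊 1 → 𝔼 4}
    (h : IsSmoothModelIsotopy r K K') : IsModelKnot r K := by
  obtain ⟨H, -, h0, -, hH⟩ := h
  simpa [h0 0 le_rfl] using hH 0

/-- The target of a smooth isotopy of model knots is a model knot. [folklore] -/
theorem IsSmoothModelIsotopy.isModelKnot_right {K K' : 𝕊 1 → 𝔼 4}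
    (h : IsSmoothModelIsotopy r K K') : IsModelKnot r K' := by
  obtain ⟨H, -, -, h1, hH⟩ := h
  simpa [h1 1 le_rfl] using hH 1

/-- Smooth isotopy of model knots is symmetric (run the isotopy backwards, `s ↦ 1 - s`).
[folklore] -/
theorem IsSmoothModelIsotopy.symm {K K' : 𝕊 1 → 𝔼 4} (h : IsSmoothModelIsotopy r K K') :
    IsSmoothModelIsotopy r K' K := by
  obtain ⟨H, hH, h0, h1, hK⟩ := h
  refine ⟨fun s ↦ H (1 - s), ?_, fun s hs ↦ h1 _ (by linarith), fun s hs ↦ h0 _ (by linarith),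
    fun s ↦ hK _⟩
  have hφ : ContMDiff (𝓘(ℝ, ℝ).prod (𝓡 1)) (𝓘(ℝ, ℝ).prod (𝓡 1)) ∞
      (fun p : ℝ × (𝕊 1) ↦ ((1 : ℝ) - p.1, p.2)) :=
    ((contDiff_const.sub contDiff_id).contMDiff.comp contMDiff_fst).prodMk contMDiff_snd
  exact hH.comp hφ

/-- A smooth isotopy is an isotopy. [folklore] -/
theorem IsSmoothModelIsotopy.isModelIsotopic {K K' : 𝕊 1 → 𝔼 4}
    (h : IsSmoothModelIsotopy r K K') : IsModelIsotopic r K K' :=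
  Relation.TransGen.single h

/-- A model knot is isotopic to itself. [folklore] -/
theorem IsModelIsotopic.refl {K : 𝕊 1 → 𝔼 4} (hK : IsModelKnot r K) : IsModelIsotopic r K K :=
  (IsSmoothModelIsotopy.refl hK).isModelIsotopic

/-- Isotopy of model knots is transitive. [folklore] -/
theorem IsModelIsotopic.trans {K K' K'' : 𝕊 1 → 𝔼 4} (h : IsModelIsotopic r K K')
    (h' : IsModelIsotopic r K' K'') : IsModelIsotopic r K K'' :=
  Relation.TransGen.trans h h'

/-- Isotopy of model knots is symmetric. [folklore] -/
theorem IsModelIsotopic.symm {K K' : 𝕊 1 → 𝔼 4} (h : IsModelIsotopic r K K') :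
    IsModelIsotopic r K' K := by
  induction h with
  | single h => exact h.symm.isModelIsotopic
  | tail _ h ih => exact h.symm.isModelIsotopic.trans ih

/-- Isotopic model knots are model knots (left end). [folklore] -/
theorem IsModelIsotopic.isModelKnot_left {K K' : 𝕊 1 → 𝔼 4} (h : IsModelIsotopic r K K') :
    IsModelKnot r K := by
  induction h with
  | single h => exact h.isModelKnot_left
  | tail _ _ ih => exact ih

/-- Isotopic model knots are model knots (right end). [folklore] -/
theorem IsModelIsotopic.isModelKnot_right {K K' : 𝕊 1 → 𝔼 4} (h : IsModelIsotopic r K K') :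
    IsModelKnot r K' := by
  induction h with
  | single h => exact h.isModelKnot_right
  | tail _ h _ => exact h.isModelKnot_right

/-- **The Rasmussen invariant of the finite approximation**: `finiteApprox r k K` is (the underlying
map of) a smooth knot `K₃ : 𝕊¹ ↪ 𝕊³` of the tree with `s(K₃) = s` in the sense of
`Knot.HasRasmussenInvariant` (`LeeRasmussen`). The knot structure is asserted, not constructed:
for a model knot missing the cores it exists (smooth embeddings compose).
[cite: ManolescuMarengonSarkarWillis2023, Prop. 8.2] -/
def ApproxHasRasmussen (r : ℕ) (k : ℤ) (K : 𝕊 1 → 𝔼 4) (s : ℤ) : Prop :=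
  ∃ K₃ : Knot, ⇑K₃ = finiteApprox r k K ∧ K₃.HasRasmussenInvariant s

/-- **`s₋(K) = s`** — the Manolescu–Marengon–Sarkar–Willis invariant `s₋ = s` of the null-homologous
knot `K ⊂ M_r = #ʳ(S¹ × S²)` is `s` (MMSW Def. 3.1, Def. 8.1), DEFINED through the finite
approximation theorem (Thm. 1.4 / Prop. 8.2 (i): `s₋(L) = s(D(k⃗))` for all large `k`): `K` is
null-homologous, and some model knot `K'` isotopic to `K` in `M_r` and missing the core circles
`{w = 0}` has ordinary Rasmussen invariant `s(D(k⃗)) = s` for all sufficiently large `k ∈ ℤ`,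
`D(k⃗) = finiteApprox r k K'`.  Independent of `K'` and well defined for every null-homologous
model knot by MMSW Thms. 1.3, 1.4, 2.8 (`MMSWRasmussenFacts.existsUnique_hasSMinus`); for a knot in
a ball it is the ordinary `s` (Example 8.3). [cite: ManolescuMarengonSarkarWillis2023, Def. 8.1 and Prop. 8.2 (i)] -/
def HasSMinus (r : ℕ) (K : 𝕊 1 → 𝔼 4) (s : ℤ) : Prop :=
  IsNullHomologous r K ∧
    ∃ K' : ((𝕊 1) → 𝔼 4), IsModelIsotopic r K K' ∧ (∀ t, wC (K' t) ≠ 0) ∧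
      ∃ k₀ : ℤ, ∀ k, k₀ ≤ k → ApproxHasRasmussen r k K' s

/-- **The mirror** `ρ(z, w) = (z̄, w)`, i.e. `x₁ ↦ -x₁`: an orientation-reversing involution of
`ℝ⁴` preserving `D_r` and `M_r = ∂D_r` (the holes are centred on the real axis).  In the standard
picture it is `height ↦ -height`: all crossings changed, MMSW's recipe for the mirror `m(L)`
(§2.3); any orientation-reversing self-diffeomorphism of `M_r` differs from `m` by an
orientation-preserving one, under which `s_±` is invariant (Thm. 2.8).
[cite: ManolescuMarengonSarkarWillis2023, §2.3] -/
def modelMirror (x : 𝔼 4) : 𝔼 4 := !₂[x 0, -x 1, x 2, x 3]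

/-- The mirror fixes `x₀`. [folklore] -/
@[simp] theorem modelMirror_apply_zero (x : 𝔼 4) : modelMirror x 0 = x 0 := by simp [modelMirror]

/-- The mirror negates `x₁`. [folklore] -/
@[simp] theorem modelMirror_apply_one (x : 𝔼 4) : modelMirror x 1 = -x 1 := by simp [modelMirror]

/-- The mirror fixes `x₂`. [folklore] -/
@[simp] theorem modelMirror_apply_two (x : 𝔼 4) : modelMirror x 2 = x 2 := by simp [modelMirror]

/-- The mirror fixes `x₃`. [folklore] -/
@[simp] theorem modelMirror_apply_three (x : 𝔼 4) : modelMirror x 3 = x 3 := by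
  simp [modelMirror]

/-- The mirror conjugates `z`. [folklore] -/
@[simp] theorem zC_modelMirror (x : 𝔼 4) : zC (modelMirror x) = conj (zC x) :=
  Complex.ext (by simp) (by simp)

/-- The mirror fixes `w`. [folklore] -/
@[simp] theorem wC_modelMirror (x : 𝔼 4) : wC (modelMirror x) = wC x :=
  Complex.ext (by simp) (by simp)

/-- The mirror is an involution. [folklore] -/
@[simp] theorem modelMirror_modelMirror (x : 𝔼 4) : modelMirror (modelMirror x) = x := by
  ext i; fin_cases i <;> simp

/-- The mirror preserves the hole terms. [folklore] -/
@[simp] theorem holeTerm_modelMirror (j : Fin r) (x : 𝔼 4) :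
    holeTerm r j (modelMirror x) = holeTerm r j x := by
  simp [holeTerm]

/-- The mirror preserves the level function `G_r`. [folklore] -/
@[simp] theorem levelFun_modelMirror (x : 𝔼 4) : levelFun r (modelMirror x) = levelFun r x := by
  simp [levelFun, holeTerm]

/-- The mirror preserves the model boundary `M_r`. [folklore] -/
theorem modelMirror_mem_modelBoundary_iff (x : 𝔼 4) :
    modelMirror x ∈ modelBoundary r ↔ x ∈ modelBoundary r := by
  simp [mem_modelBoundary_iff]

/-- The mirror as a continuous linear automorphism of `ℝ⁴`. [folklore] -/
def mirrorEquiv : 𝔼 4 ≃L[ℝ] 𝔼 4 :=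
  LinearEquiv.toContinuousLinearEquiv
    { toFun := modelMirror
      map_add' := fun x y ↦ by ext i; fin_cases i <;> simp [modelMirror, add_comm]
      map_smul' := fun c x ↦ by ext i; fin_cases i <;> simp [modelMirror]
      invFun := modelMirror
      left_inv := modelMirror_modelMirror
      right_inv := modelMirror_modelMirror }

/-- The underlying map of `mirrorEquiv` is the mirror. [folklore] -/
@[simp] theorem coe_mirrorEquiv : ⇑mirrorEquiv = modelMirror := rfl

/-- The mirror is injective. [folklore] -/
theorem modelMirror_injective : Injective modelMirror := mirrorEquiv.injective

/-- The mirror is smooth. [folklore] -/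
theorem contMDiff_modelMirror : ContMDiff 𝓘(ℝ, 𝔼 4) 𝓘(ℝ, 𝔼 4) ∞ modelMirror :=
  (mirrorEquiv : 𝔼 4 →L[ℝ] 𝔼 4).contDiff.contMDiff

/-- **The mirror of a model knot is a model knot** (composition of a smooth embedding with a linear
automorphism of `ℝ⁴` preserving `∂D_r`). [folklore] -/
theorem IsModelKnot.modelMirror_comp {K : 𝕊 1 → 𝔼 4} (hK : IsModelKnot r K) :
    IsModelKnot r (modelMirror ∘ K) := by
  refine ⟨contMDiff_modelMirror.comp hK.1, modelMirror_injective.comp hK.2.1, fun t ↦ ?_,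
    fun t ↦ (modelMirror_mem_modelBoundary_iff _).2 (hK.mem t)⟩
  have h1 : MDifferentiableAt 𝓘(ℝ, 𝔼 4) 𝓘(ℝ, 𝔼 4) modelMirror (K t) :=
    contMDiff_modelMirror.mdifferentiableAt (by simp)
  have h2 : MDifferentiableAt (𝓡 1) 𝓘(ℝ, 𝔼 4) K t := hK.1.mdifferentiableAt (by simp)
  rw [mfderiv_comp t h1 h2, mfderiv_eq_fderiv,
    show fderiv ℝ modelMirror (K t) = (mirrorEquiv : 𝔼 4 →L[ℝ] 𝔼 4) from
      (mirrorEquiv : 𝔼 4 →L[ℝ] 𝔼 4).fderiv]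
  exact mirrorEquiv.injective.comp (hK.2.2.1 t)

/-- The mirror of a model knot is a model knot, and conversely. [folklore] -/
theorem isModelKnot_modelMirror_comp_iff (K : 𝕊 1 → 𝔼 4) :
    IsModelKnot r (modelMirror ∘ K) ↔ IsModelKnot r K := by
  refine ⟨fun h ↦ ?_, IsModelKnot.modelMirror_comp⟩
  have := h.modelMirror_comp
  rwa [← Function.comp_assoc, show modelMirror ∘ modelMirror = id from
    funext modelMirror_modelMirror, Function.id_comp] at this

/-- The mirror of a smooth isotopy of model knots is one. [folklore] -/
theorem IsSmoothModelIsotopy.modelMirror_comp {K K' : 𝕊 1 → 𝔼 4}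
    (h : IsSmoothModelIsotopy r K K') :
    IsSmoothModelIsotopy r (modelMirror ∘ K) (modelMirror ∘ K') := by
  obtain ⟨H, hH, h0, h1, hK⟩ := h
  refine ⟨fun s ↦ modelMirror ∘ H s, contMDiff_modelMirror.comp hH, fun s hs ↦ ?_,
    fun s hs ↦ ?_, fun s ↦ (hK s).modelMirror_comp⟩
  · show modelMirror ∘ H s = _
    rw [h0 s hs]
  · show modelMirror ∘ H s = _
    rw [h1 s hs]

/-- The mirrors of isotopic model knots are isotopic. [folklore] -/
theorem IsModelIsotopic.modelMirror_comp {K K' : 𝕊 1 → 𝔼 4} (h : IsModelIsotopic r K K') :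
    IsModelIsotopic r (modelMirror ∘ K) (modelMirror ∘ K') := by
  induction h with
  | single h => exact h.modelMirror_comp.isModelIsotopic
  | tail _ h ih => exact ih.trans h.modelMirror_comp.isModelIsotopic

/-- **`(mD)(k⃗) = m(D(-k⃗))`**: the standard picture of `σ^k` of the mirrored point is the
reflection `height ↦ -height` of the picture of `σ^{-k}` of the point (away from the poles).
This is the identity behind MMSW's Prop. 8.2 (ii), `s₊(L) = s₊(D(-k⃗))` for large `k`.
[cite: ManolescuMarengonSarkarWillis2023, Prop. 8.2 (proof)] -/
theorem draw_sphereTwist_modelMirror {x : 𝔼 4} (hx : ∀ j : Fin r, (1 : ℝ) ≤ holeTerm r j x)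
    (k : ℤ) :
    draw r (sphereTwist r k (modelMirror x)) =
      ((draw r (sphereTwist r (-k) x)).1, -(draw r (sphereTwist r (-k) x)).2) := by
  have hz := zC_ne_holeCentre hx
  have hu1 : ‖twistUnit r (zC x)‖ = 1 := norm_twistUnit hz
  have hinv : conj (twistUnit r (zC x)) = (twistUnit r (zC x))⁻¹ := by
    rw [Complex.inv_def, Complex.normSq_eq_norm_sq, hu1]
    simp
  have key : conj (wC x * conj (twistUnit r (zC x)) ^ k) =
      conj (wC x * twistUnit r (zC x) ^ (-k)) := by
    rw [map_mul, map_mul, map_zpow₀, map_zpow₀, Complex.conj_conj, hinv, zpow_neg, inv_zpow,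
      inv_inv]
  have hn : ‖wC x * conj (twistUnit r (zC x)) ^ k‖ = ‖wC x * twistUnit r (zC x) ^ (-k)‖ := by
    rw [← Complex.norm_conj, key, Complex.norm_conj]
  simp only [draw, drawC, zC_sphereTwist, wC_sphereTwist, zC_modelMirror, wC_modelMirror,
    twistUnit_conj, Complex.conj_re, Complex.conj_im, key, hn]

/-- **`s₊(K) = s`** — the Manolescu–Marengon–Sarkar–Willis invariant `s₊(L) = -s(-L)` (Def. 8.1;
`-L = r(m(L))` the mirror reverse) of the null-homologous knot `K ⊂ M_r` is `s`: here
`s₋(ρ ∘ K) = -s` for the model mirror `ρ` (`modelMirror`), using that `s_±` is insensitive to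
reversal (Prop. 8.8 (1)) and to the choice of orientation-reversing diffeomorphism (Thm. 2.8).
Equivalently (Prop. 8.2 (ii), via `draw_sphereTwist_modelMirror` and `s(K̄) = -s(K)`):
`s(D(-k⃗)) = s` for all large `k`. [cite: ManolescuMarengonSarkarWillis2023, Def. 8.1 and Prop. 8.8 (1)] -/
def HasSPlus (r : ℕ) (K : 𝕊 1 → 𝔼 4) (s : ℤ) : Prop :=
  HasSMinus r (modelMirror ∘ K) (-s)

/-- `s₋` is only asserted of null-homologous knots. [cite: ManolescuMarengonSarkarWillis2023, Def. 8.1] -/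
theorem HasSMinus.isNullHomologous {K : 𝕊 1 → 𝔼 4} {s : ℤ} (h : HasSMinus r K s) :
    IsNullHomologous r K :=
  h.1

/-- `s₋` is only asserted of model knots. [cite: ManolescuMarengonSarkarWillis2023, Def. 8.1] -/
theorem HasSMinus.isModelKnot {K : 𝕊 1 → 𝔼 4} {s : ℤ} (h : HasSMinus r K s) :
    IsModelKnot r K := by
  obtain ⟨-, K', hK', -, -⟩ := h
  exact hK'.isModelKnot_left

/-- `s₊(K) = s` unfolds to `s₋(ρ ∘ K) = -s`. [cite: ManolescuMarengonSarkarWillis2023, Def. 8.1] -/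
theorem hasSPlus_iff (K : 𝕊 1 → 𝔼 4) (s : ℤ) :
    HasSPlus r K s ↔ HasSMinus r (modelMirror ∘ K) (-s) :=
  Iff.rfl

/-- Conversely `s₋(K) = s` iff `s₊(ρ ∘ K) = -s` (`ρ` is an involution). [cite: ManolescuMarengonSarkarWillis2023, Prop. 8.8 (1)] -/
theorem hasSMinus_iff_hasSPlus_modelMirror (K : 𝕊 1 → 𝔼 4) (s : ℤ) :
    HasSMinus r K s ↔ HasSPlus r (modelMirror ∘ K) (-s) := by
  rw [hasSPlus_iff, neg_neg]
  have : modelMirror ∘ (modelMirror ∘ K) = K := by funext t; simp [Function.comp_apply]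
  rw [this]

/-! ## Sanity checks on the model -/

/-- Non-vacuity: the point `(0, 0, 1, 0)` (`z = 0`, `w = 1`) lies on `M_0 = S³ = {|z|²/40² + |w|² = 1}`.
[folklore] -/
example : (!₂[0, 0, 1, 0] : 𝔼 4) ∈ modelBoundary 0 := by
  refine ⟨fun j ↦ j.elim0, ?_⟩
  simp [levelFun]

/-- Non-vacuity with one handle: the point `z = 4 + 2i` (above the hole centred at `c_0 = 4`),
`w = √(239/320)`, lies on `M_1`: `20/80² + 1/4 + 239/320 = 1`. [folklore] -/
example : (!₂[4, 2, Real.sqrt (239 / 320), 0] : 𝔼 4) ∈ modelBoundary 1 := by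
  refine ⟨fun j ↦ ?_, ?_⟩
  · fin_cases j
    simp [holeTerm]
  · have h : (Real.sqrt 239 / Real.sqrt 320) ^ 2 = 239 / 320 := by
      rw [div_pow, Real.sq_sqrt (by norm_num), Real.sq_sqrt (by norm_num)]
    simp only [levelFun, holeTerm, Fin.sum_univ_one, Fin.val_zero, Nat.cast_zero, Nat.cast_one]
    simp only [Fin.isValue, Matrix.cons_val_zero, Matrix.cons_val_one, Matrix.cons_val]
    norm_num [h]

end MMSW

end Literature.Topology.FourManifolds

end
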